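import Summits.HubbardSuperconductivity.HubbardSuperconductivity.Theorems.WidthHaldaneDirichletBlockSums
import Mathlib.Analysis.SpecialFunctions.Trigonometric.Bounds
import Mathlib.Analysis.Real.Pi.Bounds

/-!
# Two-sided bounds on the Dirichlet ratio and the real-arithmetic core of the uniform kinetic floor

Support file for the tube cruxes stated over `WidthHaldaneDefs` (routes `WidthHaldane`,
`SeamInduction`; items stmt-HubbardSuperconductivity-16311/16312/18509/18510), all PROVED, no
definitions, no named facts. `WidthHaldaneTubeFreeKineticNumber.kineticFloor_window_closedForm`
gives the kinetic floor of crux idea `landau-window-yrast` (hypothesis (i) `KineticFloorAt` of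
`stiffnessOfLandauCriterion` / `tubeStiffness_ge_of_landauWindow`) with an explicit but
size-dependent closed form in the Dirichlet ratios `S(m,N) = sin((2m+1)π/N)/sin(π/N)` of a box
Fermi sea `(2m₁+1) × (2m₂+1)` and a dual transverse level `m`. This file supplies the elementary
analysis that makes the constant WIDTH-UNIFORM (assembled in
`WidthHaldaneTubeKineticFloorUniform`):

* `dirichletRatio_ge_of_near` — `(N/π) sin(πa) - 2 ≤ S(m,N)` when `2m+1 ∈ [aN-2, aN]`
  (`sin(π/N) ≤ π/N`, `|sin x - sin y| ≤ |x - y|`);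
* `dirichletRatio_le_of_le` — `sin(tπ/M)/sin(π/M) ≤ (M/π) sin(πν) + 1/M` for `0 ≤ t ≤ νM`,
  `ν ≤ 1/2`, `M ≥ 3` (monotonicity of `sin` on `[0, π/2]`, `sin x ≥ x - x³/6`);
* `exists_odd_block_near`, `exists_dual_level` — the discrete choices `2m+1 ∈ [aN-2, aN]`
  (`m = ⌊(aN-1)/2⌋`) and `2m-1 ∈ [νM-2, νM]`, `1 ≤ m`, `2m ≤ M` (`m = ⌊(νM+1)/2⌋`);
* **`closedForm_ge_core`** — with blocks `p ∈ [αL-2, αL]`, `q ∈ [βM-2, βM]`, dual level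
  `t ≥ νM - 2`, the two ratio bounds and the budget `69 + w ≤ εM` (`1 ≤ M ≤ L`), the closed form
  `2[q·2S₁ + p·2S₂ - 4(n - pq)] - 2[2L·S_t + 2(n - tL)] - Un - wM/L` is at least
  `(k₀ - Uν - ε)·LM`, `k₀ = (4/π)(β sin πα + α sin πβ) - 8(ν - αβ) - (4/π) sin πν` — every loss
  (Lipschitz rounding of the blocks, box remainder `≤ (ν-αβ)LM + 2L + 2M`, transverse remainder
  `≤ 2L`, the `x³/6` correction, the window term) is `O(L + M)` (linear arithmetic after the
  product bounds; `1/π` and `1/M` enter as abstract constants `c ≤ 1/3`, `i_M ≤ 1`).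

[cite: ScalapinoWhiteZhang1993, §II]
-/

noncomputable section

namespace Summit.HubbardSuperconductivity.HubbardSuperconductivity.Theorems.WidthHaldane

set_option linter.dupNamespace false -- summit = problem name (single-conjunct summit), D-0017

open scoped BigOperators Classical
open Literature.MathematicalPhysics.QuantumLattice

/-! ### Two-sided elementary bounds on the Dirichlet ratio `S(m,N) = sin((2m+1)π/N)/sin(π/N)` -/

section Trig

/-- **Lower bound on the Dirichlet ratio near a target fraction**: if `2m+1 ≤ N` (`N ≥ 2`) and the
odd integer `2m+1` lies in `[aN - 2, aN]`, then `(N/π)·sin(πa) - 2 ≤ sin((2m+1)π/N)/sin(π/N)`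
(`sin(π/N) ≤ π/N` and `|sin x - sin y| ≤ |x - y|`). [folklore] -/
theorem dirichletRatio_ge_of_near {N m : ℕ} {a : ℝ} (hN : 2 ≤ N) (h : 2 * m + 1 ≤ N)
    (ha : a * N - 2 ≤ 2 * (m : ℝ) + 1) (ha' : 2 * (m : ℝ) + 1 ≤ a * N) :
    1 / Real.pi * N * Real.sin (Real.pi * a) - 2 ≤
      Real.sin ((2 * (m : ℝ) + 1) * Real.pi / N) / Real.sin (Real.pi / N) := by
  have hNpos : (0 : ℝ) < N := by exact_mod_cast (by omega : 0 < N)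
  have hπ := Real.pi_pos
  have hsinpos : 0 < Real.sin (Real.pi / N) := sin_pi_div_pos hN
  have hsinle : Real.sin (Real.pi / N) ≤ Real.pi / N := Real.sin_le (by positivity)
  have hcast : (2 * (m : ℝ) + 1) ≤ N := by exact_mod_cast h
  -- the numerator is non-negative
  have hnum0 : 0 ≤ Real.sin ((2 * (m : ℝ) + 1) * Real.pi / N) := by
    apply Real.sin_nonneg_of_nonneg_of_le_pi (by positivity)
    rw [div_le_iff₀ hNpos]
    nlinarith
  -- Lipschitz step
  have hlip : Real.sin (Real.pi * a) - 2 * Real.pi / N ≤ Real.sin ((2 * (m : ℝ) + 1) * Real.pi / N) := by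
    have h1 := Real.abs_sin_sub_sin_le (Real.pi * a) ((2 * (m : ℝ) + 1) * Real.pi / N)
    have h2 : |Real.pi * a - (2 * (m : ℝ) + 1) * Real.pi / N| ≤ 2 * Real.pi / N := by
      rw [abs_le]
      constructor
      · have h3 : (2 * (m : ℝ) + 1) * Real.pi / N ≤ Real.pi * a := by
          rw [div_le_iff₀ hNpos]
          nlinarith
        have h4 : 0 ≤ 2 * Real.pi / N := by positivity
        linarith
      · have h3 : Real.pi * a - 2 * Real.pi / N ≤ (2 * (m : ℝ) + 1) * Real.pi / N := by
          rw [show Real.pi * a - 2 * Real.pi / N = (Real.pi * a * N - 2 * Real.pi) / N by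
            field_simp, div_le_div_iff_of_pos_right hNpos]
          nlinarith
        linarith
    have h3 := (abs_sub_le_iff.1 (h1.trans h2)).1
    linarith
  calc 1 / Real.pi * N * Real.sin (Real.pi * a) - 2
      = (Real.sin (Real.pi * a) - 2 * Real.pi / N) / (Real.pi / N) := by
        field_simp
    _ ≤ Real.sin ((2 * (m : ℝ) + 1) * Real.pi / N) / (Real.pi / N) :=
        div_le_div_of_nonneg_right hlip (by positivity)
    _ ≤ Real.sin ((2 * (m : ℝ) + 1) * Real.pi / N) / Real.sin (Real.pi / N) :=
        div_le_div_of_nonneg_left hnum0 hsinpos hsinle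

/-- **Upper bound on the Dirichlet ratio below quarter filling of the circle**: for `M ≥ 3`,
`0 ≤ t ≤ νM` and `ν ≤ 1/2`, `sin(tπ/M)/sin(π/M) ≤ (M/π)·sin(πν) + 1/M` (monotonicity of `sin` on
`[0, π/2]` for the numerator, `sin x ≥ x - x³/6` for the denominator). [folklore] -/
theorem dirichletRatio_le_of_le {M : ℕ} {t ν : ℝ} (hM : 3 ≤ M) (ht0 : 0 ≤ t) (ht : t ≤ ν * M)
    (hν : ν ≤ 1 / 2) :
    Real.sin (t * Real.pi / M) / Real.sin (Real.pi / M) ≤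
      1 / Real.pi * M * Real.sin (Real.pi * ν) + 1 / M := by
  have hMpos : (0 : ℝ) < M := by exact_mod_cast (by omega : 0 < M)
  have hM3 : (3 : ℝ) ≤ M := by exact_mod_cast hM
  have hπ := Real.pi_pos
  have hπ4 : Real.pi ≤ 3.1416 := Real.pi_lt_d4.le
  have hν0 : 0 ≤ ν := by nlinarith
  set x : ℝ := Real.pi / M with hx
  have hxpos : 0 < x := by positivity
  have hxle : x ≤ Real.pi / 3 := div_le_div_of_nonneg_left hπ.le (by norm_num) hM3
  have hx11 : x ≤ 1.1 := by linarith
  have hsin_lb : x - x ^ 3 / 6 < Real.sin x := Real.sin_gt_sub_cube hxpos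
  have hsinpos : 0 < Real.sin x := sin_pi_div_pos (by omega)
  -- numerator `≤ sin(πν)`
  have hnum : Real.sin (t * Real.pi / M) ≤ Real.sin (Real.pi * ν) := by
    apply Real.sin_le_sin_of_le_of_le_pi_div_two
    · have h0 : 0 ≤ t * Real.pi / M := by positivity
      linarith
    · nlinarith
    · rw [div_le_iff₀ hMpos]
      nlinarith
  have hs1 : Real.sin (Real.pi * ν) ≤ 1 := Real.sin_le_one _
  have hs0 : 0 ≤ Real.sin (Real.pi * ν) :=
    Real.sin_nonneg_of_nonneg_of_le_pi (by positivity) (by nlinarith)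
  have hMx : 1 / Real.pi * (M : ℝ) = 1 / x := by rw [hx]; field_simp
  have hMx' : (1 : ℝ) / M = x / Real.pi := by rw [hx]; field_simp
  calc Real.sin (t * Real.pi / M) / Real.sin x
      ≤ Real.sin (Real.pi * ν) / Real.sin x := div_le_div_of_nonneg_right hnum hsinpos.le
    _ ≤ 1 / Real.pi * M * Real.sin (Real.pi * ν) + 1 / M := by
        rw [div_le_iff₀ hsinpos, hMx, hMx']
        have hcoef : 0 ≤ 1 / x * Real.sin (Real.pi * ν) + x / Real.pi := by positivity
        have h1 : (1 / x * Real.sin (Real.pi * ν) + x / Real.pi) * (x - x ^ 3 / 6) ≤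
            (1 / x * Real.sin (Real.pi * ν) + x / Real.pi) * Real.sin x :=
          mul_le_mul_of_nonneg_left hsin_lb.le hcoef
        have h2 : Real.sin (Real.pi * ν) ≤
            (1 / x * Real.sin (Real.pi * ν) + x / Real.pi) * (x - x ^ 3 / 6) := by
          rw [show (1 / x * Real.sin (Real.pi * ν) + x / Real.pi) * (x - x ^ 3 / 6) =
              Real.sin (Real.pi * ν) + x ^ 2 * ((6 - x ^ 2 - Real.pi * Real.sin (Real.pi * ν)) /
                (6 * Real.pi)) by
            field_simp
            ring]
          have h3 : 0 ≤ (6 - x ^ 2 - Real.pi * Real.sin (Real.pi * ν)) / (6 * Real.pi) := by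
            apply div_nonneg _ (by positivity)
            nlinarith
          nlinarith [sq_nonneg x]
        linarith

end Trig

/-! ### The discrete choices: odd blocks near a target fraction, the dual transverse level -/

section Choices

/-- An odd block size `2m+1 ≤ N` within `2` of a target `aN` (`a ≤ 1 ≤ aN`): `m = ⌊(aN-1)/2⌋`.
[folklore] -/
theorem exists_odd_block_near {N : ℕ} {a : ℝ} (ha1 : a ≤ 1) (haN : 1 ≤ a * N) :
    ∃ m : ℕ, 2 * m + 1 ≤ N ∧ 2 * (m : ℝ) + 1 ≤ a * N ∧ a * N - 2 ≤ 2 * (m : ℝ) + 1 := by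
  have hN0 : (0 : ℝ) ≤ N := Nat.cast_nonneg N
  have h0 : 0 ≤ (a * N - 1) / 2 := by linarith
  have hfl := Nat.floor_le h0
  have hlt := Nat.lt_floor_add_one ((a * N - 1) / 2)
  refine ⟨⌊(a * N - 1) / 2⌋₊, ?_, by linarith, by linarith⟩
  have h1 : (2 * (⌊(a * N - 1) / 2⌋₊ : ℝ) + 1) ≤ N := by nlinarith
  exact_mod_cast h1

/-- The dual transverse level: for `ν ≤ 1/2`, `1 ≤ νM` (`M ≥ 2`) there is `m ≥ 1` with `2m ≤ M`
and `νM - 2 ≤ 2(m-1)+1 = 2m-1 ≤ νM`: `m = ⌊(νM+1)/2⌋`. [folklore] -/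
theorem exists_dual_level {M : ℕ} {ν : ℝ} (hν : ν ≤ 1 / 2) (hνM : 1 ≤ ν * M) (hM : 2 ≤ M) :
    ∃ m : ℕ, 1 ≤ m ∧ 2 * m ≤ M ∧ 2 * ((m - 1 : ℕ) : ℝ) + 1 ≤ ν * M ∧
      ν * M - 2 ≤ 2 * ((m - 1 : ℕ) : ℝ) + 1 ∧ ((2 * m - 1 : ℕ) : ℝ) = 2 * ((m - 1 : ℕ) : ℝ) + 1 := by
  have hM0 : (2 : ℝ) ≤ M := by exact_mod_cast hM
  have h0 : 0 ≤ (ν * M + 1) / 2 := by linarith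
  have hfl := Nat.floor_le h0
  have hlt := Nat.lt_floor_add_one ((ν * M + 1) / 2)
  set m : ℕ := ⌊(ν * M + 1) / 2⌋₊ with hm
  have hm1 : 1 ≤ m := by
    rw [hm, Nat.one_le_floor_iff]
    linarith
  have hcast : ((m - 1 : ℕ) : ℝ) = (m : ℝ) - 1 := by
    rw [Nat.cast_sub hm1, Nat.cast_one]
  have hcast' : ((2 * m - 1 : ℕ) : ℝ) = 2 * (m : ℝ) - 1 := by
    rw [Nat.cast_sub (by omega), Nat.cast_mul]
    norm_num
  refine ⟨m, hm1, ?_, ?_, ?_, ?_⟩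
  · have h1 : (2 * (m : ℝ)) ≤ M := by nlinarith
    exact_mod_cast h1
  · rw [hcast]; linarith
  · rw [hcast]; linarith
  · rw [hcast, hcast']; ring

end Choices

/-! ### The real-arithmetic core: closed form `≥ (k₀ - Uν - ε)·LM` for near-optimal parameters -/

section Core

/-- **The closed form dominates `(k₀ - Uν - ε)·LM`** once the blocks `p = 2m₁+1 ∈ [αL-2, αL]`,
`q = 2m₂+1 ∈ [βM-2, βM]`, the dual level `t = 2m-1 ≥ νM-2`, the Dirichlet ratios
(`S₁ ≥ cL·s_α - 2`, `S₂ ≥ cM·s_β - 2`, `S_t ≤ cM·s_ν + i_M`, `s_• ∈ [0,1]` the sines, `c = 1/π ≤ 1/3`,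
`i_M = 1/M ≤ 1`), the window term `w_{ML} = wM/L ≤ w` and the budget `69 + w ≤ εM` (`1 ≤ M ≤ L`) are
in place; `k₀ = 4c(β s_α + α s_β) - 8(ν - αβ) - 4c·s_ν`. Pure (linear-after-products) real
arithmetic. [folklore] -/
theorem closedForm_ge_core {L M α β ν p q t n S₁ S₂ St sa sb sn U w ε c iM wML : ℝ}
    (hM1 : 1 ≤ M) (hML : M ≤ L) (hα1 : α ≤ 1) (hβ1 : β ≤ 1)
    (hαL : 2 ≤ α * L) (hβM : 2 ≤ β * M)
    (hp : α * L - 2 ≤ p) (hp' : p ≤ α * L) (hq : β * M - 2 ≤ q) (hq' : q ≤ β * M)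
    (ht : ν * M - 2 ≤ t) (hn : n ≤ ν * (L * M))
    (hsa0 : 0 ≤ sa) (hsa1 : sa ≤ 1) (hsb0 : 0 ≤ sb) (hsb1 : sb ≤ 1)
    (hc0 : 0 ≤ c) (hc : c ≤ 1 / 3) (hiM : iM ≤ 1)
    (hS₁ : c * L * sa - 2 ≤ S₁) (hS₂ : c * M * sb - 2 ≤ S₂) (hSt : St ≤ c * M * sn + iM)
    (hU : 0 ≤ U) (hw : 0 ≤ w) (hwML : wML ≤ w) (hεM : 69 + w ≤ ε * M) :
    (4 * c * (β * sa + α * sb) - 8 * (ν - α * β) - 4 * c * sn - U * ν - ε) * (L * M) ≤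
      2 * (q * (2 * S₁) + p * (2 * S₂) - 4 * (n - p * q)) - 2 * (2 * L * St + 2 * (n - t * L)) -
        U * n - wML := by
  have hL1 : 1 ≤ L := hM1.trans hML
  have hL0 : 0 ≤ L := by linarith
  have hM0 : 0 ≤ M := by linarith
  have hq0 : 0 ≤ q := by linarith
  have hp0 : 0 ≤ p := by linarith
  have h3' : α * L ≤ L := by nlinarith
  have h3'' : β * M ≤ M := by nlinarith
  have hqM : q ≤ M := hq'.trans h3''
  have hpL : p ≤ L := hp'.trans h3'
  -- box part
  have hLsa : 0 ≤ c * L * sa := by positivity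
  have hMsb : 0 ≤ c * M * sb := by positivity
  have h1 : q * (c * L * sa - 2) ≤ q * S₁ := mul_le_mul_of_nonneg_left hS₁ hq0
  have h1' : (β * M - 2) * (c * L * sa) ≤ q * (c * L * sa) := mul_le_mul_of_nonneg_right hq hLsa
  have h2 : p * (c * M * sb - 2) ≤ p * S₂ := mul_le_mul_of_nonneg_left hS₂ hp0
  have h2' : (α * L - 2) * (c * M * sb) ≤ p * (c * M * sb) := mul_le_mul_of_nonneg_right hp hMsb
  have h1'' : c * L * sa ≤ 1 / 3 * L := by
    have : c * sa ≤ 1 / 3 * 1 := mul_le_mul hc hsa1 hsa0 (by norm_num)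
    nlinarith
  have h2'' : c * M * sb ≤ 1 / 3 * M := by
    have : c * sb ≤ 1 / 3 * 1 := mul_le_mul hc hsb1 hsb0 (by norm_num)
    nlinarith
  -- remainder
  have h3 : (α * L - 2) * (β * M - 2) ≤ p * q := mul_le_mul hp hq (by linarith) hp0
  -- transverse part
  have h4 : (ν * M - 2) * L ≤ t * L := mul_le_mul_of_nonneg_right ht hL0
  have h5 : 2 * L * St ≤ 2 * L * (c * M * sn + iM) := mul_le_mul_of_nonneg_left hSt (by positivity)
  have h5' : 2 * L * iM ≤ 2 * L * 1 := mul_le_mul_of_nonneg_left hiM (by positivity)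
  -- interaction, budget
  have h6 : U * n ≤ U * (ν * (L * M)) := mul_le_mul_of_nonneg_left hn hU
  have h8 : L * (69 + w) ≤ L * (ε * M) := mul_le_mul_of_nonneg_left hεM hL0
  have h9 : w * 1 ≤ w * L := mul_le_mul_of_nonneg_left hL1 hw
  linarith [h1, h1', h2, h2', h1'', h2'', h3, h3', h3'', h4, h5, h5', h6, h8, h9]

end Core

end Summit.HubbardSuperconductivity.HubbardSuperconductivity.Theorems.WidthHaldane

end
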